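import Mathlib.NumberTheory.NumberField.Basic
import Mathlib.FieldTheory.Normal.Closure
import Mathlib.FieldTheory.Galois.Basic
import Mathlib.FieldTheory.IsAlgClosed.Basic
import Mathlib.Analysis.Complex.Polynomial.Basic
import HarnessLib

/-!
# A finite Galois envelope inside `ℂ`: every finite-dimensional subfield `E₀ ⊆ ℂ` containing `ι(F)` lies in the image of a
# finite Galois extension `Fᵢ₀ ∕ F` embedded in `ℂ` over `ι`

Topic `NumberTheory/NumberFields`; namespace `Literature.NumberTheory.NumberFields`.  THEOREMS ONLY (no `def`, no named fact, no instance, no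
notation, no `sorry`).  Cell `hodgecm-mathlib` (D-0151), FLOOR 0, P6, E-line `F0_P6a_PELWitnessE`: the `∃ Fᵢ₀` clause of `stub_E123` (shape (α′)):
the slice field over which the auxiliary Siegel chart's reciprocity holds is any finite Galois `Fᵢ₀ ∕ F` whose complex image contains the number
field `E₀` of ★ `F0P6aSpecialPairRecipOfChart.exists_sliceField_f_recip` ([RapoportSmithlingZhang2020Diagonal] (3.10): the auxiliary model lives over
`E ⊇ φ₀(F)·E_Φ`, Remark 3.1 «`E` may be larger»).  Construction: the normal closure of `E₀ ∕ F` inside `ℂ` (Mathlib `normalClosure`,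
`isNormalClosure_normalClosure` — `ℂ` is algebraically closed so every minimal polynomial splits), which is finite over `F`, normal, separable in
characteristic `0`, hence Galois, and a number field.

* `exists_isGalois_envelope` — the statement above.

## References
* [RapoportSmithlingZhang2020Diagonal] M. Rapoport, B. Smithling, W. Zhang, *Arithmetic diagonal cycles on unitary Shimura varieties*,
  Compos. Math. 156 (2020), Remark 3.1 p. 9 and (3.10) p. 12.
* [Milne2005ShimuraVarieties] J. S. Milne, *Introduction to Shimura varieties* (2005), §12 pp. 111–114 (reflex fields; models over larger fields).
-/

set_option autoImplicit false

noncomputable section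

namespace Literature.NumberTheory.NumberFields

/-- **A finite Galois envelope inside `ℂ`.**  For a number field `F` with a complex embedding `ι` and a finite-dimensional subfield `E₀ ⊆ ℂ`
containing `ι(F)`, there is a finite Galois extension `Fᵢ₀ ∕ F` (a number field) with a complex embedding `τ₀` extending `ι` whose image
contains `E₀` — the normal closure of `E₀ ∕ F` in `ℂ`. [cite: RapoportSmithlingZhang2020Diagonal, Remark 3.1 p. 9 and (3.10) p. 12]
[cite: Milne2005ShimuraVarieties, §12 pp. 111–114] -/
theorem exists_isGalois_envelope {F : Type} [Field F] [NumberField F] (ι : F →+* ℂ)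
    (E₀ : IntermediateField ℚ ℂ) (hfd : FiniteDimensional ℚ ↥E₀) (hι : ∀ x : F, ι x ∈ E₀) :
    ∃ (Fi₀ : Type) (_ : Field Fi₀) (_ : NumberField Fi₀) (_ : Algebra F Fi₀) (_ : IsGalois F Fi₀) (τ₀ : Fi₀ →+* ℂ),
      τ₀.comp (algebraMap F Fi₀) = ι ∧ ∀ x : ℂ, x ∈ E₀ → ∃ y : Fi₀, τ₀ y = x := by
  classical
  -- `E₀` and `ℂ` as `F`-algebras through `ι`
  letI : Algebra F ℂ := ι.toAlgebra
  letI : Algebra F ↥E₀ := (ι.codRestrict E₀ hι).toAlgebra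
  haveI : IsScalarTower F ↥E₀ ℂ := IsScalarTower.of_algebraMap_eq fun _ => rfl
  haveI : FiniteDimensional ℚ ↥E₀ := hfd
  haveI : IsScalarTower ℚ F ↥E₀ := IsScalarTower.of_algebraMap_eq fun q => ((algebraMap F ↥E₀).map_rat_algebraMap q).symm
  haveI : Module.Finite F ↥E₀ := Module.Finite.of_restrictScalars_finite ℚ F ↥E₀
  -- the normal closure of `E₀ ∕ F` inside `ℂ`
  haveI hNC : IsNormalClosure F ↥E₀ ↥(IntermediateField.normalClosure F ↥E₀ ℂ) :=
    Algebra.IsAlgebraic.isNormalClosure_normalClosure fun x => IsAlgClosed.splits _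
  haveI : Normal F ↥(IntermediateField.normalClosure F ↥E₀ ℂ) := IsNormalClosure.normal (K := ↥E₀)
  haveI : FiniteDimensional F ↥(IntermediateField.normalClosure F ↥E₀ ℂ) := normalClosure.is_finiteDimensional F ↥E₀ ℂ
  haveI : IsScalarTower ℚ F ↥(IntermediateField.normalClosure F ↥E₀ ℂ) :=
    IsScalarTower.of_algebraMap_eq fun q => ((algebraMap F ↥(IntermediateField.normalClosure F ↥E₀ ℂ)).map_rat_algebraMap q).symm
  haveI : FiniteDimensional ℚ ↥(IntermediateField.normalClosure F ↥E₀ ℂ) := Module.Finite.trans F ↥(IntermediateField.normalClosure F ↥E₀ ℂ)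
  haveI : NumberField ↥(IntermediateField.normalClosure F ↥E₀ ℂ) := NumberField.mk
  haveI : IsGalois F ↥(IntermediateField.normalClosure F ↥E₀ ℂ) := IsGalois.mk
  refine ⟨↥(IntermediateField.normalClosure F ↥E₀ ℂ), inferInstance, inferInstance, inferInstance, inferInstance,
    algebraMap ↥(IntermediateField.normalClosure F ↥E₀ ℂ) ℂ, (IsScalarTower.algebraMap_eq F ↥(IntermediateField.normalClosure F ↥E₀ ℂ) ℂ).symm, fun x hx => ?_⟩
  have hxN : x ∈ IntermediateField.normalClosure F ↥E₀ ℂ :=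
    AlgHom.fieldRange_le_normalClosure (IsScalarTower.toAlgHom F ↥E₀ ℂ) ⟨⟨x, hx⟩, rfl⟩
  exact ⟨⟨x, hxN⟩, rfl⟩

end Literature.NumberTheory.NumberFields

end
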